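import Literature.AlgebraicGeometry.HodgeTheory.SmoothQuasiProjectiveComponents
import Literature.AlgebraicGeometry.Motives.HeightMorphism
import Literature.AlgebraicGeometry.Motives.ClosedGraphMorphism
import Literature.AlgebraicGeometry.Motives.VarietiesDimensionProofs
import Literature.AlgebraicGeometry.Dimension.SmoothRelativeDimensionOfClosedPoints
import Literature.AlgebraicGeometry.Resolution.FibreComponentsBaseChange
import HarnessLib

/-!
# A closed surjective morphism of smooth quasi-projective complex schemes has, over every point of a piece of
# dimension `≥ G`, a point on a piece of dimension `≥ G` (dominant components)

Topic `Literature/AlgebraicGeometry/HodgeTheory`; namespace `Literature.AlgebraicGeometry.HodgeTheory`.  THEOREMS ONLY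
(no definition, no named fact, no instance, no notation, no `sorry`).  Cell hodgecm-mathlib (D-0151), E-road
«EQUIDIM by proof», Hecke-link line card v1/v1.1 (B-plan1 (g14)), socket (A) `SocketThickLinkedLift` — the
«DOMINANCE» brick (B-plan1 (g14) 2026-08-29T19:10:10Z): the up-transfer of thickness along the level-lowering map
`tr : 𝓜_{N·m} → 𝓜_N`, modulo the ONE binder «`tr_ℂ` is a closed map» (`TrClosed`).  Count-neutral capital: HC_CM is
proved only modulo the 7 printed citations until rung 0 closes; this file discharges none of them.

## The mathematics

Let `φ : X′ → X` be a morphism of smooth quasi-projective `ℂ`-schemes which is CLOSED on underlying spaces and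
SURJECTIVE on complex points.  `X` and `X′` are finite disjoint unions of irreducible clopen pieces, each smooth of
some pure relative dimension (★ `exists_components_isColimit_of_smooth`, [GortzWedhorn2020] Ex. 3.16 / Thm. 6.28,
[SGA1] XII 2.4).  Let `s ∈ X(ℂ)` lie on an open piece `S₀ ⊆ X` smooth of relative dimension `d₀ ≥ G`; let `P` be the
irreducible clopen piece of `X` through `s`, `dim P = d₀` (local rings at `s` agree along the two open immersions,
[GortzWedhorn2020] Lemma 6.26 / Thm. 6.28 (vi)).  The images `φ(R_c)` of the pieces `R_c` of `X′` are closed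
(closed map) and irreducible and cover `X` (they contain every closed point by surjectivity on `ℂ`-points, and closed
points are dense in the Jacobson space `X`), so the irreducible `P` lies in ONE of them, `P ⊆ φ(R_{c₀})`
([Hartshorne1977] I Prop. 1.5 / Mathlib `isIrreducible_iff_sUnion_isClosed`).  Generic points: `φ(R_{c₀})` is the
closure of `φ(ξ_{c₀})`, so the generic point `ζ` of `P` specialises from `φ(ξ_{c₀})` and
`d₀ = dim P = ht ζ ≤ ht φ(ξ_{c₀}) ≤ ht ξ_{c₀} = dim R_{c₀} = d_{c₀}` ([GortzWedhorn2020] Thm. 5.22 (1): heights are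
transcendence degrees of residue fields, ★ `Motives.height_base_le_height_of_schemeOver`).  Finally `s ∈ P ⊆ φ(R_{c₀})`
gives a closed point of `R_{c₀}` over `s`, i.e. a complex point `y` of the piece `E_{c₀}` (relative dimension
`d_{c₀} ≥ G`) with `φ(y) = s`.

INSTANCE (Hecke-link B2, integrator B-p01 (g13) / B-p13 (g16)): `X′ = 𝓜_{N·m,ℂ}`, `X = 𝓜_{N,ℂ}`, `φ = tr_ℂ` (closed by the
socket `TrClosed`, surjective on `ℂ`-points by ★ (P1) `SiegelModuliTower.exists_comp_tr_eq` p739560-lineage), `G =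
g(g+1)/2`, `S₀` = the thick piece of H0 (B-p13 (g16)); conclusion = a THICK point upstairs over the chosen thick point
downstairs (then `isThickAt_iff_le`, B-p01 (g13)).

## References
* [GortzWedhorn2020] U. Görtz, T. Wedhorn, *Algebraic Geometry I*, 2nd ed. (2020), Thm. 5.22 (1) (p. 129), Lemma 6.26,
  Thm. 6.28 (vi), Exercise 3.16 (p. 92).
* [Hartshorne1977] R. Hartshorne, *Algebraic Geometry* (1977), I Prop. 1.5 and Cor. 1.6 (p. 5), II Ex. 3.20.
* [StacksProject] Tag 0ECG (Lemma 29.45.9: closed maps with incomparable fibres preserve dimension), Tag 005Z (Jacobson spaces).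
-/

set_option autoImplicit false

noncomputable section

open CategoryTheory CategoryTheory.Limits AlgebraicGeometry Set Function Order
open Literature.AlgebraicTopology.SingularHomology (IsClopenPartition)

namespace Literature.AlgebraicGeometry.HodgeTheory

open _root_.Topology
open Literature.AlgebraicGeometry.Motives

universe u

/-! ## §1 Topological lemmas -/

/-- **An irreducible set covered by finitely many closed sets lies in one of them** (Mathlib
`isIrreducible_iff_sUnion_isClosed`, indexed form). [cite: Hartshorne1977, I Prop. 1.5 (p. 5)] -/
theorem exists_subset_of_isIrreducible_of_subset_iUnion {α : Type*} [TopologicalSpace α] {ι : Type*} [Finite ι]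
    {S : Set α} (hS : IsIrreducible S) {Z : ι → Set α} (hZ : ∀ i, IsClosed (Z i)) (h : S ⊆ ⋃ i, Z i) :
    ∃ i, S ⊆ Z i := by
  classical
  haveI := Fintype.ofFinite ι
  obtain ⟨z, hz, hSz⟩ := (isIrreducible_iff_sUnion_isClosed.mp hS) (Finset.univ.image Z)
    (by
      intro z hz
      obtain ⟨i, -, rfl⟩ := Finset.mem_image.mp hz
      exact hZ i)
    (by
      intro x hx
      obtain ⟨i, hi⟩ := Set.mem_iUnion.mp (h hx)
      exact Set.mem_sUnion.mpr ⟨Z i, by simp, hi⟩)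
  obtain ⟨i, -, rfl⟩ := Finset.mem_image.mp hz
  exact ⟨i, hSz⟩

/-- **In a Jacobson space a closed set containing every closed point is everything** (closed points are dense in
closed subsets, Mathlib `JacobsonSpace.closure_inter_closedPoints`). [cite: StacksProject, Tag 005Z] -/
theorem eq_univ_of_isClosed_of_closedPoints_subset {α : Type*} [TopologicalSpace α] [JacobsonSpace α] {Z : Set α}
    (hZ : IsClosed Z) (h : closedPoints α ⊆ Z) : Z = Set.univ := by
  refine Set.eq_univ_of_univ_subset ?_
  have huniv : closure (Set.univ ∩ closedPoints α) = (Set.univ : Set α) :=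
    JacobsonSpace.closure_inter_closedPoints isClosed_univ
  rw [← huniv, Set.univ_inter]
  exact closure_minimal h hZ

/-- **In a Jacobson space every non-empty closed set contains a closed point.** [cite: StacksProject, Tag 005Z] -/
theorem exists_mem_closedPoints_of_isClosed_of_nonempty {α : Type*} [TopologicalSpace α] [JacobsonSpace α]
    {Z : Set α} (hZ : IsClosed Z) (hne : Z.Nonempty) : ∃ z ∈ Z, z ∈ closedPoints α := by
  by_contra hcon
  push Not at hcon
  have hempty : Z ∩ closedPoints α = ∅ := Set.eq_empty_of_forall_notMem fun z hz => hcon z hz.1 hz.2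
  have h := JacobsonSpace.closure_inter_closedPoints hZ
  rw [hempty, closure_empty] at h
  exact hne.ne_empty h.symm

/-- **The image of an irreducible closed set under a closed continuous map is the closure of the image of its generic
point** (schemes are sober). [cite: StacksProject, Tag 0ECG] -/
theorem image_eq_closure_image_genericPoint {α β : Type*} [TopologicalSpace α] [TopologicalSpace β] [QuasiSober α]
    {f : α → β} (hf : Continuous f) (hcl : IsClosedMap f) {R : Set α} (hR : IsIrreducible R) (hRc : IsClosed R) :
    f '' R = closure {f hR.genericPoint} := by
  have hgen : closure ({hR.genericPoint} : Set α) = R := hR.closure_genericPoint hRc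
  rw [← Set.image_singleton, hcl.closure_image_eq_of_continuous hf, hgen]

/-! ## §2 Dimension bookkeeping for pieces -/

/-- **The Krull dimension of a local ring is unchanged along an open immersion** (the stalk map is an isomorphism).
[cite: GortzWedhorn2020, Lemma 6.26] -/
theorem ringKrullDim_stalk_eq_of_isOpenImmersion {S X : Scheme.{u}} (f : S ⟶ X) [IsOpenImmersion f] (p : S) :
    ringKrullDim (X.presheaf.stalk (f.base p)) = ringKrullDim (S.presheaf.stalk p) :=
  ringKrullDim_eq_of_ringEquiv (asIso (f.stalkMap p)).commRingCatIsoToRingEquiv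

/-- **The topological Krull dimension of the (closed) range of an open-and-closed immersion equals that of the
source.** [cite: GortzWedhorn2020, Lemma 5.7] -/
theorem topologicalKrullDim_range_eq {S X : Scheme.{u}} (f : S ⟶ X) [IsClosedImmersion f] :
    topologicalKrullDim ↥(Set.range f.base) = topologicalKrullDim S :=
  (IsHomeomorph.topologicalKrullDim_eq _ f.isClosedEmbedding.isEmbedding.toHomeomorph.isHomeomorph).symm

/-- **The dimension of an irreducible closed subset of a scheme is the height of its generic point** (Mathlib's
specialisation order `a ≤ b ↔ b ⤳ a`; ★ `Resolution.topologicalKrullDim_closure_singleton_eq_height`).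
[cite: GortzWedhorn2020, Lemma 5.7] -/
theorem topologicalKrullDim_eq_height_genericPoint {X : Scheme.{u}} {R : Set X} (hR : IsIrreducible R)
    (hRc : IsClosed R) : topologicalKrullDim ↥R = (height hR.genericPoint : ℕ∞) := by
  have hgen : closure ({hR.genericPoint} : Set X) = R := hR.closure_genericPoint hRc
  have h := Literature.AlgebraicGeometry.Resolution.topologicalKrullDim_closure_singleton_eq_height hR.genericPoint
  rwa [hgen] at h

/-! ## §3 The dominant piece over a point -/

variable {X X' : SchemeOver ℂ}

/-- **The images of the irreducible clopen pieces of `X′` under a closed map which is surjective on complex points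
cover `X`** (each image is closed; together they contain every closed point; `X` is Jacobson).
[cite: StacksProject, Tag 005Z] [cite: GortzWedhorn2020, Exercise 3.16 (p. 92)] -/
theorem iUnion_image_range_eq_univ [LocallyOfFiniteType X.hom] [LocallyOfFiniteType X'.hom]
    (φ : X' ⟶ X) (hcl : IsClosedMap φ.left.base)
    (hsurj : ∀ x : ComplexPoints X, ∃ y : ComplexPoints X', AlgPoints.map φ y = x)
    {C : Type} [Finite C] {E : C → SchemeOver ℂ} (e : ∀ c, E c ⟶ X') (hEc : ∀ c, IsClosedImmersion (e c).left)
    (hpart : IsClopenPartition (fun c => Set.range (AlgPoints.map (L := ℂ) (e c)))) :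
    (⋃ c, φ.left.base '' Set.range (e c).left.base) = Set.univ := by
  haveI : JacobsonSpace ↥X.left := LocallyOfFiniteType.jacobsonSpace X.hom
  refine eq_univ_of_isClosed_of_closedPoints_subset ?_ ?_
  · exact isClosed_iUnion_of_finite fun c => hcl _ (e c).left.isClosedEmbedding.isClosed_range
  · intro x hx
    obtain ⟨z, hz⟩ := AlgPoints.exists_pt_eq_of_isClosed_singleton (X := X) (K := ℂ) (mem_closedPoints_iff.mp hx)
    obtain ⟨y, hy⟩ := hsurj z
    obtain ⟨c, w, hw⟩ := hpart.exists_mem y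
    refine Set.mem_iUnion.mpr ⟨c, (e c).left.base w.pt, ⟨w.pt, rfl⟩, ?_⟩
    rw [← hz, ← hy, ← hw, AlgPoints.pt_map, AlgPoints.pt_map]

/-- **DOMINANT PIECE OVER A POINT.**  Let `φ : X′ ⟶ X` be a morphism of smooth quasi-projective `ℂ`-schemes whose
underlying map is CLOSED and which is SURJECTIVE on complex points, and let `s` be a complex point of an open piece
`ι₀ : S₀ ⟶ X` smooth of relative dimension `d₀ ≥ G`.  Then some complex point `y` of an irreducible open-and-closed
piece `ι′ : S″ ⟶ X′`, smooth of relative dimension `d″ ≥ G` and quasi-projective, maps to `s`: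
`φ (ι′ y) = ι₀ s`.  (Hecke-link «DOMINANCE»: components of `𝓜_{N·m,ℂ}` over a thick component are thick, given that
`tr_ℂ` is closed.) [cite: GortzWedhorn2020, Thm. 5.22 (1) (p. 129) and Exercise 3.16 (p. 92)]
[cite: Hartshorne1977, I Prop. 1.5 (p. 5)] [cite: StacksProject, Tag 0ECG] -/
theorem exists_piece_le_of_isClosedMap [Smooth X.hom] (hX : IsQuasiProjectiveOver X) [Smooth X'.hom]
    (hX' : IsQuasiProjectiveOver X') (φ : X' ⟶ X) (hcl : IsClosedMap φ.left.base)
    (hsurj : ∀ x : ComplexPoints X, ∃ y : ComplexPoints X', AlgPoints.map φ y = x)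
    {S₀ : SchemeOver ℂ} (ι₀ : S₀ ⟶ X) [IsOpenImmersion ι₀.left] (d₀ : ℕ) [SmoothOfRelativeDimension d₀ S₀.hom]
    (s : ComplexPoints S₀) {G : ℕ} (hG : G ≤ d₀) :
    ∃ (S'' : SchemeOver ℂ) (ι' : S'' ⟶ X') (_ : IsOpenImmersion ι'.left) (_ : IsClosedImmersion ι'.left)
      (_ : IrreducibleSpace S''.left) (_ : IsQuasiProjectiveOver S'') (d'' : ℕ) (_ : SmoothOfRelativeDimension d'' S''.hom)
      (y : ComplexPoints S''), G ≤ d'' ∧ AlgPoints.map φ (AlgPoints.map ι' y) = AlgPoints.map ι₀ s := by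
  haveI : LocallyOfFiniteType X.hom := hX.locallyOfFiniteType
  haveI : LocallyOfFiniteType X'.hom := hX'.locallyOfFiniteType
  haveI : JacobsonSpace ↥X'.left := LocallyOfFiniteType.jacobsonSpace X'.hom
  -- the pieces of `X` and of `X′`
  obtain ⟨B, hBfin, F, fb, hFo, hFc, hFirr, hFqp, hFdim, -, hFpart, -, -⟩ := exists_components_isColimit_of_smooth X hX
  obtain ⟨C, hCfin, E, e, hEo, hEc, hEirr, hEqp, hEdim, -, hEpart, -, -⟩ := exists_components_isColimit_of_smooth X' hX'
  haveI := hBfin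
  haveI := hCfin
  -- the point and its piece downstairs
  set x : ComplexPoints X := AlgPoints.map ι₀ s with hxdef
  obtain ⟨b, t, ht⟩ := hFpart.exists_mem x
  haveI := hFo b
  haveI := hFc b
  haveI := hFirr b
  obtain ⟨db, hdb⟩ := hFdim b
  haveI := hdb
  haveI : LocallyOfFiniteType (F b).hom := (hFqp b).locallyOfFiniteType
  -- `d_b = d₀`: the local rings of `X` at `x` through the two open immersions
  have hdbd₀ : db = d₀ := by
    have h1 : ringKrullDim ((F b).left.presheaf.stalk t.pt) = db :=
      Dimension.ringKrullDim_stalk_eq_of_smoothOfRelativeDimension_of_isClosed (F b).hom db t.isClosed_singleton_pt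
    have h2 : ringKrullDim (S₀.left.presheaf.stalk s.pt) = d₀ := by
      haveI : LocallyOfFiniteType S₀.hom := by
        haveI : Smooth S₀.hom := SmoothOfRelativeDimension.smooth d₀ _
        infer_instance
      exact Dimension.ringKrullDim_stalk_eq_of_smoothOfRelativeDimension_of_isClosed S₀.hom d₀ s.isClosed_singleton_pt
    have h3 : ringKrullDim (X.left.presheaf.stalk x.pt) = db := by
      rw [← ht, AlgPoints.pt_map, ringKrullDim_stalk_eq_of_isOpenImmersion, h1]
    have h4 : ringKrullDim (X.left.presheaf.stalk x.pt) = d₀ := by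
      rw [hxdef, AlgPoints.pt_map, ringKrullDim_stalk_eq_of_isOpenImmersion, h2]
    have h := h3.symm.trans h4
    exact_mod_cast h
  -- the closed irreducible piece `P = range (fb b)` through `x`
  set P : Set ↥X.left := Set.range (fb b).left.base with hPdef
  have hPirr : IsIrreducible P := by
    rw [hPdef, ← Set.image_univ]
    exact (IrreducibleSpace.isIrreducible_univ _).image _ (fb b).left.base.hom.continuous.continuousOn
  have hPcl : IsClosed P := (fb b).left.isClosedEmbedding.isClosed_range
  have hxP : x.pt ∈ P := ⟨t.pt, by rw [← ht, AlgPoints.pt_map]⟩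
  -- the pieces upstairs cover `X` after `φ`, so `P ⊆ φ (R_{c₀})`
  have hcover := iUnion_image_range_eq_univ φ hcl hsurj e hEc hEpart
  obtain ⟨c₀, hPc₀⟩ := exists_subset_of_isIrreducible_of_subset_iUnion hPirr
    (Z := fun c => φ.left.base '' Set.range (e c).left.base)
    (fun c => hcl _ (e c).left.isClosedEmbedding.isClosed_range) (by rw [hcover]; exact Set.subset_univ _)
  haveI := hEo c₀
  haveI := hEc c₀
  haveI := hEirr c₀
  obtain ⟨dc, hdc⟩ := hEdim c₀
  haveI := hdc
  haveI : LocallyOfFiniteType (E c₀).hom := (hEqp c₀).locallyOfFiniteType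
  set R : Set ↥X'.left := Set.range (e c₀).left.base with hRdef
  have hRirr : IsIrreducible R := by
    rw [hRdef, ← Set.image_univ]
    exact (IrreducibleSpace.isIrreducible_univ _).image _ (e c₀).left.base.hom.continuous.continuousOn
  have hRcl : IsClosed R := (e c₀).left.isClosedEmbedding.isClosed_range
  -- generic points and the dimension count `d_b ≤ d_c`
  have himg : φ.left.base '' R = closure {φ.left.base hRirr.genericPoint} :=
    image_eq_closure_image_genericPoint φ.left.base.hom.continuous hcl hRirr hRcl
  have hζ : hPirr.genericPoint ∈ closure ({φ.left.base hRirr.genericPoint} : Set ↥X.left) := by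
    rw [← himg]
    exact hPc₀ (hPirr.isGenericPoint_genericPoint hPcl).mem
  have hle₁ : height hPirr.genericPoint ≤ height (φ.left.base hRirr.genericPoint) :=
    height_mono (Scheme.le_iff_specializes.mpr (specializes_iff_mem_closure.mpr hζ))
  have hle₂ : height (φ.left.base hRirr.genericPoint) ≤ height hRirr.genericPoint :=
    height_base_le_height_of_schemeOver φ hRirr.genericPoint
  have hdimP : topologicalKrullDim ↥P = (db : WithBot ℕ∞) := by
    haveI : Nonempty ↥(F b).left := ⟨t.pt⟩
    rw [hPdef, topologicalKrullDim_range_eq]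
    exact topologicalKrullDim_eq_of_smoothOfRelativeDimension (F b).hom db
  have hdimR : topologicalKrullDim ↥R = (dc : WithBot ℕ∞) := by
    haveI : Nonempty ↥(E c₀).left := by
      obtain ⟨-, ⟨q, -⟩⟩ := hRirr.nonempty
      exact ⟨q⟩
    rw [hRdef, topologicalKrullDim_range_eq]
    exact topologicalKrullDim_eq_of_smoothOfRelativeDimension (E c₀).hom dc
  have hle : (db : WithBot ℕ∞) ≤ (dc : WithBot ℕ∞) := by
    rw [← hdimP, ← hdimR, topologicalKrullDim_eq_height_genericPoint hPirr hPcl,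
      topologicalKrullDim_eq_height_genericPoint hRirr hRcl]
    exact_mod_cast hle₁.trans hle₂
  have hGdc : G ≤ dc := by
    have h : db ≤ dc := by exact_mod_cast hle
    omega
  -- a closed point of `R` over `x`, i.e. a complex point of `E c₀`
  obtain ⟨p, hpR, hpx⟩ : ∃ p ∈ R, φ.left.base p = x.pt := hPc₀ hxP
  have hTcl : IsClosed (R ∩ φ.left.base ⁻¹' {x.pt}) :=
    hRcl.inter ((AlgPoints.isClosed_singleton_pt x).preimage φ.left.base.hom.continuous)
  obtain ⟨p₁, ⟨hp₁R, hp₁x⟩, hp₁cl⟩ :=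
    exists_mem_closedPoints_of_isClosed_of_nonempty hTcl ⟨p, hpR, hpx⟩
  obtain ⟨q₁, hq₁⟩ := hp₁R
  have hq₁cl : IsClosed ({q₁} : Set ↥(E c₀).left) := by
    have hpre : (e c₀).left.base ⁻¹' {p₁} = {q₁} := by
      ext q
      simp only [Set.mem_preimage, Set.mem_singleton_iff]
      constructor
      · intro hq
        exact (e c₀).left.isClosedEmbedding.injective (hq.trans hq₁.symm)
      · rintro rfl
        exact hq₁
    rw [← hpre]
    exact (mem_closedPoints_iff.mp hp₁cl).preimage (e c₀).left.base.hom.continuous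
  obtain ⟨y, hy⟩ := AlgPoints.exists_pt_eq_of_isClosed_singleton (X := E c₀) (K := ℂ) hq₁cl
  refine ⟨E c₀, e c₀, hEo c₀, hEc c₀, hEirr c₀, hEqp c₀, dc, hdc, y, hGdc, ?_⟩
  apply AlgPoints.eq_of_pt_eq
  rw [AlgPoints.pt_map, AlgPoints.pt_map, hy, hq₁]
  exact hp₁x

end Literature.AlgebraicGeometry.HodgeTheory

end
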